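import Mathlib
import HarnessLib
import Summits.HubbardSuperconductivity.HubbardSuperconductivity.Theses.KLProgramme
import Summits.HubbardSuperconductivity.HubbardSuperconductivity.Theorems.KLProgrammeKLRegimeSplitGenericV5
import Summits.HubbardSuperconductivity.HubbardSuperconductivity.Theorems.KLProgrammeH10RungCompactBoxTruncated
import Summits.HubbardSuperconductivity.HubbardSuperconductivity.Theorems.KLProgrammeKLRegimeBetaSplitV17F2

/-!
# Route `KLProgramme` — crux K1 `H10TwoPointLimit` (stmt-HubbardSuperconductivity-19938) FROM THE FIVE v5 CHILDREN OF K3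
# (volume-limit child under the binder `R.WF2`, `VolumeLimitP3` of `…KLRegimeSplitGenericV5`), and the closer of K1 MODULO the two
# LIVE children `KLRegimeEngineV17F2` (stmt-…-20437) and `KLRegimeVolumeLimitV17F3` (stmt-…-23356)

Seat leafhand-hubbard-klprogramme-2 (K1 line `children`, 2026-08-30).  K1's registered skeleton v3 (a42510dafcf4) names the gen-6
children `KLRegimeEngineV16` / `KLRegimeVolumeLimitV16` (items 20236 / 20239, RETIRED at the gen-7/8 resplits); the children of record are
the gen-8 ones on the cured flow bundle `klPredsV17F2`, three of which are CLOSED (`betaSplitP_klPredsV17F2`,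
`countertermP2_klPredsV17F2_holds`, `twoPointAssemblyP3_ex`), with the volume-limit child RE-KEYED to `VolumeLimitP3` (binder `R.WF2`,
`KLRegimeVolumeLimitV17F3`, item 23356).  `…H10TwoPointLimitOfChildren.H10TwoPointLimit_of_childrenP4` consumes `VolumeLimitP2` and
`VolumeLimitP3` is WEAKER as a hypothesis on the child (`volumeLimitP3_of_volumeLimitP2` goes the other way), so K1 needs the v5 twin:

* `fullRange_inductionP5` — `fullRange_inductionP4` with `VolumeLimitP2 ↦ VolumeLimitP3`: the glue obtains `R` from child 2 WITH `R.WF2`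
  and passes it to child 5 (one token; `inductionP5`'s observation); the five children give the limit on `klBetaMin ≤ β ≤ e^{c/U²}`;
* `allTemperatures_inductionP5` — with the CLOSED compact-box corner (`h10rung_twoPoint_limit_box klBetaMin`, route-independent module
  `…H10RungCompactBoxTruncated`): all `0 < β ≤ e^{c/U²}`;
* `H10TwoPointLimit_of_childrenP5`, `leaf_of_childrenP5` — K1 (`a := c`, `U₀ ≤ 1`: `e^{c/U} ≤ e^{c/U²}`; S0 `MuOfDopingWindow_holds` places `μ(δ)`)
  and the rung-R2d leaf from the five v5 children of ANY bundle (the steps of `…H10TwoPointLimitOfChildren` §2–§3 inlined, so that this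
  module imports no Theorems module of the route's theses cone);
* **`H10TwoPointLimit_of_liveChildren`** — K1 from the two OPEN route decls `KLRegimeEngineV17F2` and `KLRegimeVolumeLimitV17F3` alone
  (the three closed children supplied by name): the composition of K1's re-keyed skeleton v4.

Pure logic (compositions); nothing here proves a child or asserts anything about the Hubbard model beyond the CLOSED theorems it cites.
References: BGM 2006 [cite: BenfattoGiulianiMastropietro2006, Thm 1.1 / §2].
-/

noncomputable section

namespace Summit.HubbardSuperconductivity.HubbardSuperconductivity.Theorems.KLRegimeSplit

set_option linter.dupNamespace false -- summit = problem name (single-conjunct summit), D-0017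

open Real Filter Set Literature.MathematicalPhysics.QuantumLattice Literature.Probability.LatticeModels
open Summit.HubbardSuperconductivity.HubbardSuperconductivity.Theorems.DispersionFlow

/-! ## §1 The v5 children give the FULL multiscale range `klBetaMin ≤ β ≤ e^{c/U²}` -/

/-- **The five v5 children give the two-point limit on the full multiscale range** `klBetaMin ≤ β ≤ e^{c/U²}` on the analysis
window `μ ∈ [-1, -0.15]` (covariance window `W` receiving `μ - U/2`): `fullRange_inductionP4`'s proof verbatim, the renormalisation
package `R` obtained from child 2 WITH `R.WF2` and handed to child 5 as such. [folklore: composition] -/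
theorem fullRange_inductionP5 {Pr : Preds} {VL : VolLimitSlot} {W : Set ℝ}
    (hW : ∀ μ ∈ Set.Icc (-1 : ℝ) (-0.15), ∀ U : ℝ, 0 < U → U ≤ 1 / 10 → μ - U / 2 ∈ W)
    (h₃ : EngineP4 Pr W) (h₁ : BetaSplitP Pr W) (h₂ : CountertermP2 Pr W) (h₅ : VolumeLimitP3 Pr VL W)
    (h₄ : TwoPointAssemblyP3 Pr VL W) :
    ∃ U₀ c : ℝ, 0 < U₀ ∧ 0 < c ∧ ∀ μ ∈ Set.Icc (-1 : ℝ) (-0.15), ∀ U β : ℝ, 0 < U → U ≤ U₀ →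
      klBetaMin ≤ β → β ≤ Real.exp (c / U ^ 2) → ∀ (x y : Site 2) (σ σ' : Fin 2), ∃ S : ℂ,
        Tendsto (fun L : ℕ => hubbardThermalTwoPoint β U μ L x y σ σ') atTop (nhds S) := by
  obtain ⟨G, hG, h₃P⟩ := h₃
  obtain ⟨P, hP, h₁Q⟩ := h₁ G hG
  obtain ⟨R, hR2, h₂Q⟩ := h₂ G P hG hP
  have hR : R.WF := hR2.wf
  obtain ⟨Q, hQ, c₃, hc₃, h₃c⟩ := h₃P P hP R hR2
  obtain ⟨c₀, hc₀, h₁c⟩ := h₁Q Q hQ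
  obtain ⟨c₁, hc₁, h₂c⟩ := h₂Q Q hQ
  obtain ⟨c₅, hc₅, h₅c⟩ := h₅ G P Q R hG hP hQ hR2
  set c : ℝ := min (min c₀ c₁) (min c₃ c₅) with hc_def
  have hc : 0 < c := lt_min (lt_min hc₀ hc₁) (lt_min hc₃ hc₅)
  have hcc₀ : c ≤ c₀ := (min_le_left _ _).trans (min_le_left _ _)
  have hcc₁ : c ≤ c₁ := (min_le_left _ _).trans (min_le_right _ _)
  have hcc₃ : c ≤ c₃ := (min_le_right _ _).trans (min_le_left _ _)
  have hcc₅ : c ≤ c₅ := (min_le_right _ _).trans (min_le_right _ _)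
  obtain ⟨U₃, hU₃, L₃, M₃, h₃main⟩ := h₃c c hc hcc₃
  obtain ⟨U₁, hU₁, L₁, M₁, h₁main⟩ := h₁c c hc hcc₀ R hR
  obtain ⟨U₂, hU₂, h₂main⟩ := h₂c c hc hcc₁
  obtain ⟨U₅, hU₅, h₅main⟩ := h₅c c hc hcc₅
  obtain ⟨U₄, hU₄, h₄main⟩ := h₄ G P Q R hG hP hQ hR c hc
  set U₀ : ℝ := min (min (min U₁ U₂) (min U₃ (min U₄ U₅))) (1 / 10) with hU₀_def
  have hU₀ : 0 < U₀ := lt_min (lt_min (lt_min hU₁ hU₂) (lt_min hU₃ (lt_min hU₄ hU₅))) (by norm_num)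
  refine ⟨U₀, c, hU₀, hc, ?_⟩
  intro μ hμ U β hU hUle hβmin hβc x y σ σ'
  have hUm : U ≤ min (min U₁ U₂) (min U₃ (min U₄ U₅)) := hUle.trans (min_le_left _ _)
  have hU10 : U ≤ 1 / 10 := hUle.trans (min_le_right _ _)
  have hU1 : U ≤ U₁ := hUm.trans ((min_le_left _ _).trans (min_le_left _ _))
  have hU2 : U ≤ U₂ := hUm.trans ((min_le_left _ _).trans (min_le_right _ _))
  have hU3 : U ≤ U₃ := hUm.trans ((min_le_right _ _).trans (min_le_left _ _))
  have hU4 : U ≤ U₄ := hUm.trans ((min_le_right _ _).trans ((min_le_right _ _).trans (min_le_left _ _)))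
  have hU5 : U ≤ U₅ := hUm.trans ((min_le_right _ _).trans ((min_le_right _ _).trans (min_le_right _ _)))
  have hKL : ∀ n ≤ nScales β + 1, IsKLRegime U c (-(n : ℤ)) := fun n hn =>
    isKLRegime_of_le_nScales_succ hc.le hβmin hβc hn
  -- the covariance potential
  set ν : ℝ := μ - U / 2 with hν_def
  have hν : ν ∈ W := hW μ hμ U hU hU10
  -- the glued induction (children 3 + 1) up to `n_β` for EVERY admissible frame, beyond the maxed hypothesis thresholds
  have hall : ∀ K : TrigPolyC4v, Pr.frameOK R U (nScales β) ν K →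
      ∀ (L M : ℕ) [NeZero L] [NeZero M], max (L₃ β U) (L₁ β U) ≤ L → max (M₃ β U L) (M₁ β U L) ≤ M →
        ∀ n : ℕ, n ≤ nScales β → (∀ j < n, Pr.renorm L M β U ν K R j) →
          Pr.engine L M G P Q β U ν K n ∧ Pr.twoLeg L M G P Q R β U ν K n ∧
            Pr.split L M G P Q β U ν K n := by
    intro K hK L M _ _ hL hM n hn hRn
    have hL3 : L₃ β U ≤ L := (le_max_left _ _).trans hL
    have hL1 : L₁ β U ≤ L := (le_max_right _ _).trans hL
    have hM3 : M₃ β U L ≤ M := (le_max_left _ _).trans hM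
    have hM1 : M₁ β U L ≤ M := (le_max_right _ _).trans hM
    exact Child.allScales (N := nScales β) (KL := fun n => IsKLRegime U c (-(n : ℤ)))
      (B := fun n => Pr.split L M G P Q β U ν K n) (Rn := fun n => Pr.renorm L M β U ν K R n)
      (E := fun n => Pr.engine L M G P Q β U ν K n) (T := fun n => Pr.twoLeg L M G P Q R β U ν K n)
      (fun n hn hkl hyp => h₃main ν hν U hU hU3 β hβmin hβc K hK L M hL3 hM3 n (Nat.le_succ_of_le hn) hkl hyp)
      (fun n hn hkl hyp hEn hTn => h₁main ν hν U hU hU1 β hβmin hβc K hK L M hL1 hM1 n hn hkl hyp hEn hTn)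
      (fun n hn => hKL n (Nat.le_succ_of_le hn)) n hn hRn
  -- child 2: the volume-uniform renormalised admissible frame and its thresholds
  obtain ⟨K, hK, Lc, Mc, hKR⟩ :=
    h₂main ν hν U hU hU2 β hβmin hβc (max (L₃ β U) (L₁ β U)) (fun L => max (M₃ β U L) (M₁ β U L)) hall
  -- the full tower of K beyond the max of all thresholds, including the engine's LAST step `n_β + 1`
  set Lstar : ℕ := max Lc (max (L₃ β U) (L₁ β U)) with hLstar
  set Mstar : ℕ → ℕ := fun L => max (Mc L) (max (M₃ β U L) (M₁ β U L)) with hMstar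
  have htower : TowerP Pr G P Q R β U ν K Lstar Mstar := by
    intro L M _ _ hL hM
    have hLc : Lc ≤ L := (le_max_left _ _).trans hL
    have hLh : max (L₃ β U) (L₁ β U) ≤ L := (le_max_right _ _).trans hL
    have hL3 : L₃ β U ≤ L := (le_max_left _ _).trans hLh
    have hMc : Mc L ≤ M := (le_max_left _ _).trans hM
    have hMh : max (M₃ β U L) (M₁ β U L) ≤ M := (le_max_right _ _).trans hM
    have hM3 : M₃ β U L ≤ M := (le_max_left _ _).trans hMh
    have hle : ∀ n : ℕ, n ≤ nScales β →
        Pr.renorm L M β U ν K R n ∧ Pr.split L M G P Q β U ν K n ∧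
          Pr.engine L M G P Q β U ν K n ∧ Pr.twoLeg L M G P Q R β U ν K n := by
      intro n hn
      have h := hall K hK L M hLh hMh n hn fun j hj => hKR L M hLc hMc j (le_of_lt (lt_of_lt_of_le hj hn))
      exact ⟨hKR L M hLc hMc n hn, h.2.2, h.1, h.2.1⟩
    refine ⟨hle, ?_⟩
    -- the last step: history = the tower at `j ≤ n_β`
    have hhist : HistP Pr L M G P Q R β U ν K (nScales β + 1) := by
      intro j hj
      have hj' : j ≤ nScales β := Nat.lt_succ_iff.mp hj
      have h := hle j hj'
      exact ⟨h.2.1, h.1, h.2.2.1, h.2.2.2⟩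
    exact h₃main ν hν U hU hU3 β hβmin hβc K hK L M hL3 hM3 (nScales β + 1) le_rfl (hKL _ le_rfl) hhist
  -- child 5 (binder `R.WF2`): termwise volume limits for this frame
  have hVL : VL β U ν K Mstar := h₅main ν hν U hU hU5 β hβmin hβc K hK Lstar Mstar htower
  -- child 4 at the covariance potential; its conclusion is at ν + U/2 = μ
  have hphys : ν + U / 2 = μ := by rw [hν_def]; ring
  have h4 := h₄main ν hν U hU hU4 β hβmin hβc Lstar Mstar ⟨K, hK, htower, hVL⟩ x y σ σ'
  rwa [hphys] at h4

/-! ## §2 All temperatures, K1 and the leaf from the v5 children -/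

/-- **The five v5 children give the two-point limit at ALL temperatures `0 < β ≤ e^{c/U²}`** on the analysis window
`μ ∈ [-1, -0.15]`: below `klBetaMin` the CLOSED single-scale compact-box theorem `h10rung_twoPoint_limit_box klBetaMin (-1) (-0.15)`
(uniform radius `r` on `(0, klBetaMin] × [-1, -0.15]`; shrink `U₀` to `min U₀ (r/2)`). [folklore: composition] -/
theorem allTemperatures_inductionP5 {Pr : Preds} {VL : VolLimitSlot} {W : Set ℝ}
    (hW : ∀ μ ∈ Set.Icc (-1 : ℝ) (-0.15), ∀ U : ℝ, 0 < U → U ≤ 1 / 10 → μ - U / 2 ∈ W)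
    (h₃ : EngineP4 Pr W) (h₁ : BetaSplitP Pr W) (h₂ : CountertermP2 Pr W) (h₅ : VolumeLimitP3 Pr VL W)
    (h₄ : TwoPointAssemblyP3 Pr VL W) :
    ∃ U₀ c : ℝ, 0 < U₀ ∧ 0 < c ∧ ∀ μ ∈ Set.Icc (-1 : ℝ) (-0.15), ∀ U β : ℝ, 0 < U → U ≤ U₀ →
      0 < β → β ≤ Real.exp (c / U ^ 2) → ∀ (x y : Site 2) (σ σ' : Fin 2), ∃ S : ℂ,
        Tendsto (fun L : ℕ => hubbardThermalTwoPoint β U μ L x y σ σ') atTop (nhds S) := by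
  obtain ⟨U₀, c, hU₀, hc, h⟩ := fullRange_inductionP5 hW h₃ h₁ h₂ h₅ h₄
  obtain ⟨r, hr, hbox⟩ := h10rung_twoPoint_limit_box klBetaMin (-1 : ℝ) (-0.15)
  refine ⟨min U₀ (r / 2), c, lt_min hU₀ (by positivity), hc, ?_⟩
  intro μ hμ U β hU hUle hβ hβc x y σ σ'
  by_cases hcase : β ≤ klBetaMin
  · have hUr : |U| < r := by
      rw [abs_of_pos hU]
      linarith [hUle.trans (min_le_right U₀ (r / 2))]
    exact hbox β ⟨hβ, hcase⟩ μ hμ U hUr x y σ σ'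
  · exact h μ hμ U β hU (hUle.trans (min_le_left _ _)) (le_of_lt (not_le.mp hcase)) hβc x y σ σ'

/-- **Crux K1 `H10TwoPointLimit` from the five v5 children of K3** (on the covariance window `klWindowC`) — pure logic through
`allTemperatures_inductionP5` and the CLOSED support item S0 `MuOfDopingWindow` (`a := c`, `U₀ ≤ 1`: `e^{c/U} ≤ e^{c/U²}`).
[folklore: composition] -/
theorem H10TwoPointLimit_of_childrenP5 {Pr : Preds} {VL : VolLimitSlot} (h₃ : EngineP4 Pr klWindowC)
    (h₁ : BetaSplitP Pr klWindowC) (h₂ : CountertermP2 Pr klWindowC) (h₅ : VolumeLimitP3 Pr VL klWindowC)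
    (h₄ : TwoPointAssemblyP3 Pr VL klWindowC) :
    Summit.HubbardSuperconductivity.HubbardSuperconductivity.Theses.KLProgramme.H10TwoPointLimit := by
  obtain ⟨U₀, c, hU₀, hc, h⟩ :=
    allTemperatures_inductionP5 (fun _ hμ _ hU hU' => sub_half_mem_klWindowC hμ hU hU') h₃ h₁ h₂ h₅ h₄
  refine ⟨min U₀ 1, c, lt_min hU₀ one_pos, hc, fun δ hδ U β hU hUle hβ hβa x y σ σ' => ?_⟩
  have hU1 : U ≤ 1 := hUle.trans (min_le_right _ _)
  have hexp : Real.exp (c / U) ≤ Real.exp (c / U ^ 2) := by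
    apply Real.exp_le_exp.mpr
    rw [div_le_div_iff₀ hU (by positivity)]
    nlinarith [mul_le_mul_of_nonneg_left hU1 hc.le, hU]
  exact h _ (Summit.HubbardSuperconductivity.HubbardSuperconductivity.Theses.KLProgramme.MuOfDopingWindow_holds δ hδ)
    U β hU (hUle.trans (min_le_left _ _)) hβ (hβa.trans hexp) x y σ σ'

/-- **The rung-R2d leaf `H1TwoPointLimitKLScaleD` from the five v5 children of K3**, directly (same `U₀, c`). [folklore: composition] -/
theorem leaf_of_childrenP5 {Pr : Preds} {VL : VolLimitSlot} (h₃ : EngineP4 Pr klWindowC)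
    (h₁ : BetaSplitP Pr klWindowC) (h₂ : CountertermP2 Pr klWindowC) (h₅ : VolumeLimitP3 Pr VL klWindowC)
    (h₄ : TwoPointAssemblyP3 Pr VL klWindowC) :
    Summit.HubbardSuperconductivity.HubbardSuperconductivity.Theses.WeakCouplingBCS.H1TwoPointLimitKLScaleD := by
  obtain ⟨U₀, c, hU₀, hc, h⟩ :=
    allTemperatures_inductionP5 (fun _ hμ _ hU hU' => sub_half_mem_klWindowC hμ hU hU') h₃ h₁ h₂ h₅ h₄
  exact ⟨U₀, c, hU₀, hc, fun δ hδ U β hU hUle hβ hβc x y σ σ' =>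
    h _ (Summit.HubbardSuperconductivity.HubbardSuperconductivity.Theses.KLProgramme.MuOfDopingWindow_holds δ hδ)
      U β hU hUle hβ hβc x y σ σ'⟩

/-! ## §3 K1 modulo the two LIVE children of K3 (gen 8, cured flow bundle `klPredsV17F2`) -/

/-- **Crux K1 `H10TwoPointLimit` from the two OPEN route decls of record** — the gen-8 ENGINE child `KLRegimeEngineV17F2`
(stmt-HubbardSuperconductivity-20437, `EngineP4 klPredsV17F2 klWindowC`) and the re-keyed VOLUME-LIMIT child `KLRegimeVolumeLimitV17F3`
(stmt-HubbardSuperconductivity-23356, `VolumeLimitP3 klPredsV17F2 FinalTwoLegVolLimitEx klWindowC`) — the other three children supplied by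
their landed closers: `betaSplitP_klPredsV17F2 klWindowC` (20438), `countertermP2_klPredsV17F2_holds` (20439),
`twoPointAssemblyP3_ex klPredsV17F2 klWindowC` (20441).  This is the composition of K1's skeleton re-keyed to the live children.
[folklore: composition] -/
theorem H10TwoPointLimit_of_liveChildren
    (hE : Summit.HubbardSuperconductivity.HubbardSuperconductivity.Theses.KLProgramme.KLRegimeEngineV17F2)
    (hVL : Summit.HubbardSuperconductivity.HubbardSuperconductivity.Theses.KLProgramme.KLRegimeVolumeLimitV17F3) :
    Summit.HubbardSuperconductivity.HubbardSuperconductivity.Theses.KLProgramme.H10TwoPointLimit :=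
  H10TwoPointLimit_of_childrenP5 hE (betaSplitP_klPredsV17F2 klWindowC) countertermP2_klPredsV17F2_holds hVL
    (twoPointAssemblyP3_ex klPredsV17F2 klWindowC)

/-- **The rung-R2d leaf from the two OPEN route decls of record** (same supply of the three closed children). [folklore: composition] -/
theorem leaf_of_liveChildren
    (hE : Summit.HubbardSuperconductivity.HubbardSuperconductivity.Theses.KLProgramme.KLRegimeEngineV17F2)
    (hVL : Summit.HubbardSuperconductivity.HubbardSuperconductivity.Theses.KLProgramme.KLRegimeVolumeLimitV17F3) :
    Summit.HubbardSuperconductivity.HubbardSuperconductivity.Theses.WeakCouplingBCS.H1TwoPointLimitKLScaleD :=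
  leaf_of_childrenP5 hE (betaSplitP_klPredsV17F2 klWindowC) countertermP2_klPredsV17F2_holds hVL
    (twoPointAssemblyP3_ex klPredsV17F2 klWindowC)

end Summit.HubbardSuperconductivity.HubbardSuperconductivity.Theorems.KLRegimeSplit

end
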